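import Summits.QuantumFields.YangMills.Theses.InfiniteVolumeContinuum
import Summits.QuantumFields.YangMills.Theorems.AtomicCalibrationRMirrorCalibrationDefs
import Summits.QuantumFields.YangMills.Theorems.SquareRootCeilingsMirrorDomination
import HarnessLib

/-!
# «MirrorCalibration» REV 4 on `OnsetTautology.AtomicCalibrationR` (stmt-QuantumFields-28169) — the COMPACT-WITNESS currency (K-defs)

Planner seat `ym-idea-11` g17 (planner of record of the registered skeleton `Cruxes/AtomicCalibrationR/MirrorCalibration` REV 4, sha 0c7a8dad).
Landing kit file **K1 of 4** (K1 defs · K2 B6K · K3 slot-shift toolkit · K4 B7K).  This file = the skeleton's §0K CHARACTER FOR CHARACTER (same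
namespace, so the registered stubs match by name + signature) plus the sorry-free glue:

* `LowerBoundsK` (= `DlrCollarTransfer.LowerBounds` + `HasCompactSupport` of the witnesses), `lowerBounds_of_K`;
* `OnsetFloorsK` (= `OnsetCalibration.OnsetFloors` + compact witnesses), `onsetFloors_of_K`;
* `MirrorCalibratedUnitK`, `mirrorCalibratedUnit_of_K`; `SmearedIVInputK`, `smearedIVInput_of_K`; `SmearedIVDataK := SmearedIVInputK → leaf 19868`;
* glue `subOnsetTwoPointCeilings_of_axisMirror` (landed `MirrorDomination`) and `smearedIVInputK_of : MirrorCalibratedUnitK → SmearedMomentBound → SmearedIVInputK`.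

WHY compact witnesses (prover w4 g23's B7 finding, 2026-08-29): the leaf's data clause lives at plaquette CENTRES, the floors at BASE points; the
slot shift between them keeps a tensor test off-diagonal only with MARGINS, which compact supports provide for free (K4).

HONEST LABEL: soft analysis / calibration / bookkeeping on HYPOTHESES; nothing here proves NT, a β-uniform bound, the leaf 19868
unconditionally, any crux, rung or summit; nothing about Bałaban's RG or Clay is asserted; the Yang–Mills mass gap is NOT proved.
-/

set_option autoImplicit false

noncomputable section

open scoped BigOperators
open MeasureTheory Filter Topology
open Literature.MathematicalPhysics.QuantumFieldTheory Literature.MathematicalPhysics.QuantumLattice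
open Literature.MathematicalPhysics.AQFT (IsOffDiagonal)
open Summit.QuantumFields.YangMills.Theorems.InfiniteVolume (stateMomentStr)
open Summit.QuantumFields.YangMills.Theorems.InfVolRP (centreOffset)
open Summit.QuantumFields.YangMills.Theses.OnsetTautology
  (AtomicSynthesis AtomicSqrtDominationR ComparableFloors OnsetContraction AtomicCalibrationR)

open Summit.QuantumFields.YangMills.Cruxes.OSLegsFromFemtoAndGap.DlrCollarTransfer (LowerBounds Q2 Q3)

namespace Summit.QuantumFields.YangMills.Cruxes.AtomicCalibrationR.MirrorCalibration

/-! ## §0K The compact-witness floor currency -/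

/-- **`LowerBoundsK G r a`** — `DlrCollarTransfer.LowerBounds G r a` with COMPACTLY SUPPORTED witnesses: (i) one real `v` with
compact support inside the open positive-time half-space and `ε ≤ Q2(θv, v)`; (ii) three real `f, g, h` with compact, pairwise
disjoint supports and `ε ≤ |Q3(f, g, h)|`; both for all `β ≥ β₅` on all tori `2L+1` with `a(β)·L ≥ Λ₅`. -/
def LowerBoundsK (G : Type) [Group G] [TopologicalSpace G] [IsTopologicalGroup G] [CompactSpace G]
    [MeasurableSpace G] [BorelSpace G] (r : LatticeRep G) (a : ℝ → ℝ) : Prop :=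
  (∃ (v : SchwartzMap (EuclideanSpace ℝ (Fin 4)) ℝ) (ε β₅ Λ₅ : ℝ),
      HasCompactSupport (v : EuclideanSpace ℝ (Fin 4) → ℝ) ∧
      tsupport v ⊆ {y : EuclideanSpace ℝ (Fin 4) | 0 < y 0} ∧ 0 < ε ∧
      ∀ β : ℝ, β₅ ≤ β → ∀ L : ℕ, Λ₅ ≤ a β * L → ε ≤ Q2 G r β L (a β) (thetaTest 4 v) v) ∧
  (∃ (f g h : SchwartzMap (EuclideanSpace ℝ (Fin 4)) ℝ) (ε β₅ Λ₅ : ℝ),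
      HasCompactSupport (f : EuclideanSpace ℝ (Fin 4) → ℝ) ∧ HasCompactSupport (g : EuclideanSpace ℝ (Fin 4) → ℝ) ∧
      HasCompactSupport (h : EuclideanSpace ℝ (Fin 4) → ℝ) ∧
      Disjoint (tsupport f) (tsupport g) ∧ Disjoint (tsupport g) (tsupport h) ∧ Disjoint (tsupport f) (tsupport h) ∧
      0 < ε ∧ ∀ β : ℝ, β₅ ≤ β → ∀ L : ℕ, Λ₅ ≤ a β * L → ε ≤ |Q3 G r β L (a β) f g h|)

/-- Forget the compact supports. [bookkeeping] -/
theorem lowerBounds_of_K {G : Type} [Group G] [TopologicalSpace G] [IsTopologicalGroup G] [CompactSpace G]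
    [MeasurableSpace G] [BorelSpace G] {r : LatticeRep G} {a : ℝ → ℝ} (hK : LowerBoundsK G r a) :
    LowerBounds G r a := by
  obtain ⟨⟨v, ε, β₅, Λ₅, -, hv, hε, hfl⟩, ⟨f, g, h, ε', β₅', Λ₅', -, -, -, hfg, hgh, hfh, hε', hfl'⟩⟩ := hK
  exact ⟨⟨v, ε, β₅, Λ₅, hv, hε, hfl⟩, ⟨f, g, h, ε', β₅', Λ₅', hfg, hgh, hfh, hε', hfl'⟩⟩

/-- **`OnsetFloorsK`** — the shared onset-floor residual `OnsetCalibration.OnsetFloors` (items 23314 / 25892) with COMPACTLY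
SUPPORTED witnesses `v, f, g, h` (four extra conjuncts; everything else character for character). -/
def OnsetFloorsK : Prop :=
  ∀ (G : Type) [Group G] [TopologicalSpace G] [IsTopologicalGroup G] [CompactSpace G],
    IsCompactSimpleLieGroup G → Nonempty (G ≃ₜ* Matrix.specialUnitaryGroup (Fin 2) ℂ) →
    letI : MeasurableSpace G := borel G
    haveI : BorelSpace G := ⟨rfl⟩
    ∃ (r : LatticeRep G) (v f g h : SchwartzMap (EuclideanSpace ℝ (Fin 4)) ℝ) (ε Λ₅ β₅ : ℝ),
      HasCompactSupport (v : EuclideanSpace ℝ (Fin 4) → ℝ) ∧ HasCompactSupport (f : EuclideanSpace ℝ (Fin 4) → ℝ) ∧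
      HasCompactSupport (g : EuclideanSpace ℝ (Fin 4) → ℝ) ∧ HasCompactSupport (h : EuclideanSpace ℝ (Fin 4) → ℝ) ∧
      tsupport v ⊆ {y : EuclideanSpace ℝ (Fin 4) | 0 < y 0} ∧
      Disjoint (tsupport f) (tsupport g) ∧ Disjoint (tsupport g) (tsupport h) ∧ Disjoint (tsupport f) (tsupport h) ∧
      0 < ε ∧ ∀ β : ℝ, β₅ ≤ β → ∃ s : ℝ, 0 < s ∧ s ≤ 1 ∧
        (∀ L : ℕ, Λ₅ ≤ s * L → ε ≤ Q2 G r β L s (thetaTest 4 v) v) ∧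
        (∀ L : ℕ, Λ₅ ≤ s * L → ε ≤ |Q3 G r β L s f g h|)

/-- `OnsetFloorsK → OnsetFloors` (forget the compact supports); the converse is a truncation problem needing pointwise
contact control and is NOT claimed. [bookkeeping] -/
theorem onsetFloors_of_K (hK : OnsetFloorsK) : Summit.QuantumFields.YangMills.Theses.OnsetCalibration.OnsetFloors := by
  intro G _ _ _ _ hG hcl
  letI : MeasurableSpace G := borel G
  haveI : BorelSpace G := ⟨rfl⟩
  obtain ⟨r, v, f, g, h, ε, Λ₅, β₅, -, -, -, -, hv, hfg, hgh, hfh, hε, hfl⟩ := hK G hG hcl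
  exact ⟨r, v, f, g, h, ε, Λ₅, β₅, hv, hfg, hgh, hfh, hε, hfl⟩

/-- **MCU-K** — `MirrorCalibratedUnit` with the floors in the compact-witness currency `LowerBoundsK`. -/
def MirrorCalibratedUnitK : Prop :=
  ∀ (G : Type) [Group G] [TopologicalSpace G] [IsTopologicalGroup G] [CompactSpace G],
    IsCompactSimpleLieGroup G → Nonempty (G ≃ₜ* Matrix.specialUnitaryGroup (Fin 2) ℂ) →
    letI : MeasurableSpace G := borel G
    haveI : BorelSpace G := ⟨rfl⟩
    ∃ (r : LatticeRep G) (a : ℝ → ℝ) (b : SchwartzMap (EuclideanSpace ℝ (Fin 4)) ℝ) (ε : ℝ),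
      IsAdmissibleProfile b ∧ 0 < ε ∧ (∀ β, 0 < a β) ∧ Tendsto a atTop (nhds 0) ∧ LowerBoundsK G r a ∧
      ∃ β₇ : ℝ, ∀ β : ℝ, β₇ ≤ β → a β ≤ 1 ∧ ∀ μ ∈ oddTorusLimitPoints r β, ∀ s ∈ onsetSet r μ b ε, s ≤ a β

/-- **SIV-input-K** — `SmearedIVInput` with the floors in the compact-witness currency `LowerBoundsK`. -/
def SmearedIVInputK : Prop :=
  ∀ (G : Type) [Group G] [TopologicalSpace G] [IsTopologicalGroup G] [CompactSpace G],
    IsCompactSimpleLieGroup G → Nonempty (G ≃ₜ* Matrix.specialUnitaryGroup (Fin 2) ℂ) →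
    letI : MeasurableSpace G := borel G
    haveI : BorelSpace G := ⟨rfl⟩
    ∃ (r : LatticeRep G) (a : ℝ → ℝ) (c : ℕ → ℝ) (N : ℕ) (α C γ β₈ : ℝ),
      (∀ β, 0 < a β) ∧ Tendsto a atTop (nhds 0) ∧ LowerBoundsK G r a ∧
      (∀ n, 0 ≤ c n ∧ c n ≤ α * C ^ n * (n.factorial : ℝ) ^ γ) ∧
      ∀ β : ℝ, β₈ ≤ β → ∀ μ ∈ oddTorusLimitPoints r β,
        ∀ (n : ℕ) (q : Fin n → Fin 4 × Fin 4), 2 ≤ n → (∀ i, (q i).1 < (q i).2) →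
          ∀ F : SchwartzMap (Fin n → EuclideanSpace ℝ (Fin 4)) ℂ, IsOffDiagonal F →
            ‖∑' x : Fin n → (Fin 4 → ℤ), ((stateMomentStr G r μ n q x : ℝ) : ℂ) *
                F (fun l => a β • siteToE (x l) +
                  (a β / 2) • (EuclideanSpace.single (q l).1 (1 : ℝ) + EuclideanSpace.single (q l).2 (1 : ℝ)))‖ ≤
              c n * schwartzNorm (N * n) F

/-- Forget the compact supports. [bookkeeping] -/
theorem smearedIVInput_of_K (hK : SmearedIVInputK) : SmearedIVInput := by
  intro G _ _ _ _ hG hcl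
  letI : MeasurableSpace G := borel G
  haveI : BorelSpace G := ⟨rfl⟩
  obtain ⟨r, a, c, N, α, C, γ, β₈, hapos, ha0, hLB, hc, hbd⟩ := hK G hG hcl
  exact ⟨r, a, c, N, α, C, γ, β₈, hapos, ha0, lowerBounds_of_K hLB, hc, hbd⟩

/-- **SIV-K** — the smeared infinite-volume OS engine from the compact-witness input package. -/
def SmearedIVDataK : Prop :=
  SmearedIVInputK → Summit.QuantumFields.YangMills.Theses.InfiniteVolumeContinuum.HypercubicOSDataFromInfiniteVolume

/-! ## Glue (sorry-free) -/

/-- The general two-point sub-onset ceiling from the axis-mirror ceiling: SquareRootCeilings' LANDED `MirrorDomination`. -/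
theorem subOnsetTwoPointCeilings_of_axisMirror
    (h : Summit.QuantumFields.YangMills.Theses.SquareRootCeilings.AxisMirrorCeiling) :
    Summit.QuantumFields.YangMills.Theses.SquareRootCeilings.SubOnsetTwoPointCeilings :=
  Summit.QuantumFields.YangMills.Theorems.MirrorDomination.squareRootCeilings_mirrorDomination_proof h

/-- Glue (pure logic): the K-calibrated unit and the smeared moment bound assemble the K-input package. -/
theorem smearedIVInputK_of (hU : MirrorCalibratedUnitK) (hS : SmearedMomentBound) : SmearedIVInputK := by
  intro G _ _ _ _ hG hcl
  letI : MeasurableSpace G := borel G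
  haveI : BorelSpace G := ⟨rfl⟩
  obtain ⟨r, a, b, ε, hb, hε, hapos, ha0, hLB, β₇, hβ₇⟩ := hU G hG hcl
  obtain ⟨c, N, α, C, γ, β₄, hc, hbd⟩ := hS G hG hcl r b ε hb hε
  refine ⟨r, a, c, N, α, C, γ, max β₄ β₇, hapos, ha0, hLB, hc, ?_⟩
  intro β hβ μ hμ n q hn hq F hF
  exact hbd β (le_of_max_le_left hβ) μ hμ (a β) (hapos β) (hβ₇ β (le_of_max_le_right hβ)).1
    ((hβ₇ β (le_of_max_le_right hβ)).2 μ hμ) n q hn hq F hF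

end Summit.QuantumFields.YangMills.Cruxes.AtomicCalibrationR.MirrorCalibration

end
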